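import Summits.BirchSwinnertonDyer.BirchSwinnertonDyer.Theorems.CumulativeHeegnerLeopoldtEisensteinCharacterInvariantsAtThreeUnrSelmerDualMu
import Summits.BirchSwinnertonDyer.BirchSwinnertonDyer.Theorems.EisensteinPrimesGoodLatticeOmegaPrelims
import Summits.BirchSwinnertonDyer.Rank1Residual.Partition.AnticyclotomicControlJSWEmbAt
import Summits.BirchSwinnertonDyer.Rank1Residual.WAll.TargetAdditiveAtThreeCells
import Summits.BirchSwinnertonDyer.BirchSwinnertonDyer.Theorems.SchneiderFreeAdditiveX3Defs
import HarnessLib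

/-!
# Route `CumulativeHeegnerLeopoldt`, crux K2 `EisensteinCharacterInvariantsAtThree` (stmt-BirchSwinnertonDyer-24199):
# [BRram] SPLIT — residual finiteness (print modulo port) + the λ-EQUALITY (the main-conjecture content) (helper)

Lead prover `bsd-line-chl-p1` g9 (`--supports 24199`). The K2 line's stub [BRram] `stub_ramifiedBranch` (binder type
`hram` of p614352 / p681722: at the 3-RAMIFIED member `θram` of the Teichmüller pair, EVERY `Λ`-dual `Dram` of
`H¹_{𝓕_nr}(K_∞, (F/𝒪)(θram))` (unramified at `𝔭′`) is f.g., `Λ`-torsion, `μ = 0`, and `λ(𝔛_{θram}) = nφ` = the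
first-unit index of the Katz frame of the 3-unramified member) is cut in two:

* RESIDUAL `hR` — `H¹_{𝓕_nr}(K_∞, (F/𝒪)(θram))[3]` is FINITE on the Leopoldt cell (binders of `hram` up to the
  unramifiedness of `θunr`; no Katz frame, no dual). PRINT MODULO PORT: `θram` is non-anomalous at `𝔭′` on the cell
  (`θram|_{D_{𝔭′}} ∉ {𝟙, ω}` since `θunr|_{D} ≠ 𝟙` and `θsub θquot = ω`), so this is Castella–Grossi–Lee–Skinner 2022
  Prop. 14 (the route's print item 26897) composed with the Kummer comparison `(F/𝒪)(θ)[𝔭] ≅ 𝔽(θ̄)` over `K_∞`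
  (CGLS Lemma 13; for the ramified member «unramified at `𝔭′`» already forces «strict at `𝔭′`»: `I_{𝔭′}` acts by `−1`).
* LAMBDA `hλ` — `λ(Dram.X) = nφ` (binders of `hram` VERBATIM, conclusion = its last conjunct): Rubin's main conjecture
  for `θram` read through the reflection/functional equation — the character-level content proper.

`ramifiedBranch_of_residualFinite_of_lambda : hR → hλ → hram`, the torsion/`μ = 0`/f.g. conjuncts coming from the
generic Greenberg criterion `EisensteinCharacterInvariantsAtThreeUnrSelmerDualMu.finite_torsion_mu_of_finite_pTorsion_unrSelmer`
(p685753) at `M = (F/𝒪)(θram)` (`p`-primary with open stabilisers: tree `exists_pow_smul_cofree_eq_zero`,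
`isOpen_stabilizer_cofree`). THEOREMS ONLY; CONDITIONAL on `hR`, `hλ`; closes nothing. BSD is not proved for any curve.
References: [CastellaGrossiLeeSkinner2022] §1.2 Prop. 14, Lemma 13, Thm. 1.2.2; [GreenbergLNM1716] §1 p. 60;
[Rubin1991] Thm. 4.1; [KellerYin2024] Thm. 1.2.2.
-/

set_option autoImplicit false
-- `…BirchSwinnertonDyer.BirchSwinnertonDyer.Theorems…` is the problem's mandated namespace (D-0017).
set_option linter.dupNamespace false

noncomputable section

open scoped Classical

namespace Summit.BirchSwinnertonDyer.BirchSwinnertonDyer.Theorems.EisensteinCharacterInvariantsAtThreeRamifiedSplit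

open PowerSeries WeierstrassCurve NumberField IsDedekindDomain Field
  Literature.NumberTheory.EllipticCurves Literature.NumberTheory.EllipticCurves.ModularForms
  Literature.NumberTheory.EllipticCurves.Rank1Residual
  Literature.NumberTheory.EllipticCurves.KellerYin2024
  Literature.NumberTheory.EllipticCurves.GreenbergSelmer
  Literature.NumberTheory.GaloisRepresentations
  Summit.BirchSwinnertonDyer.Rank1Residual
  Summit.BirchSwinnertonDyer.Rank1Residual.X1.KellerYinMuLambdaSplit

/-- **[BRram] from residual finiteness and the λ-equality.** `hR` = «`H¹_{𝓕_nr}(K_∞, (F/𝒪)(θram))[3]` finite on the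
cell» (print modulo port: CGLS Prop. 14 + Kummer), `hλ` = «`λ(Dram.X) = nφ`» (binders of `hram` VERBATIM); conclusion
= the binder type `hram` of p614352 / p681722 VERBATIM. The finitely-generated / torsion / `μ = 0` conjuncts are
Greenberg's criterion (p685753) applied to the cofree module of `θram|_{Γ_K}`. CONDITIONAL; closes nothing.
[cite: GreenbergLNM1716, §1 p. 60 (after Conj. 1.3)] [cite: CastellaGrossiLeeSkinner2022, §1.2 Prop. 14 and Thm. 1.2.2] -/
theorem ramifiedBranch_of_residualFinite_of_lambda
    (hR : ∀ (W : WeierstrassCurve ℚ) [W.IsElliptic] [W.IsGloballyMinimal] (N : ℕ) [NeZero N] (K : Type) [Field K] [NumberField K], Summit.BirchSwinnertonDyer.Rank1Residual.Additive.ClassO6 W 3 → Literature.NumberTheory.EllipticCurves.Rank1Residual.Red W 3 → (∃ Φ : AddSubgroup (WeierstrassCurve.geomTorsion W ((3 : ℕ) : ℤ)), Literature.NumberTheory.EllipticCurves.Rank1Residual.IsRationalLine W 3 Φ ∧ ∀ (v : IsDedekindDomain.HeightOneSpectrum (NumberField.RingOfIntegers ℚ)), ((3 : ℕ) : NumberField.RingOfIntegers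 ℚ) ∈ v.asIdeal → ∀ 𝔓 ∈ v.primesAbove, ¬ (∀ g ∈ 𝔓.decompositionSubgroup (Field.absoluteGaloisGroup ℚ), ∀ P ∈ Φ, g • P = P) ∧ ¬ (∀ g ∈ 𝔓.decompositionSubgroup (Field.absoluteGaloisGroup ℚ), ∀ P : WeierstrassCurve.geomTorsion W ((3 : ℕ) : ℤ), g • P - P ∈ Φ)) → W.conductorNorm ℤ = N → Literature.NumberTheory.EllipticCurves.IsImaginaryQuadratic K → Literature.NumberTheory.EllipticCurves.SatisfiesHeegnerHypothesis N K → Odd (NumberField.discr K) → (∀ Q : (W.baseChange K).toAffine.Point, (3 : ℕ) • Q = 0 → Q = 0) → ∀ (κ : Literature.NumberTheory.EllipticCurves.ZpExtension K 3), κ.IsAnticyclotomic → ∀ (γ : Field.absoluteGaloisGroup K) [Fact (κ.IsTopGenerator γ)] (𝔭 : IsDedekindDomain.HeightOneSpectrum (NumberField.RingOfIntegers K)), ((3 : ℕ) : NumberField.RingOfIntegers K) ∈ 𝔭.asIdeal → 𝔭.asIdeal.ramificationIdx (NumberField.RingOfIntegers ℚ) = 1 → 𝔭.asIdeal.inertiaDeg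 (NumberField.RingOfIntegers ℚ) = 1 → ∀ (𝔭' : IsDedekindDomain.HeightOneSpectrum (NumberField.RingOfIntegers K)), ((3 : ℕ) : NumberField.RingOfIntegers K) ∈ 𝔭'.asIdeal → 𝔭' ≠ 𝔭 → ∀ (ι' : PadicAlgCl 3 ≃+* ℂ), Summit.BirchSwinnertonDyer.BirchSwinnertonDyer.Theorems.SchneiderFree.BranchInducesPrime 3 ι' 𝔭 → ∀ (Φ : AddSubgroup (WeierstrassCurve.geomTorsion W ((3 : ℕ) : ℤ))), Literature.NumberTheory.EllipticCurves.Rank1Residual.IsRationalLine W 3 Φ → ∀ (θsub θquot : FramedGaloisRep ℚ (padicCoeffIntegers (∅ : Set (PadicAlgCl 3))) 1), Literature.NumberTheory.EllipticCurves.KellerYin2024.IsTeichmullerLiftOn (∅ : Set (PadicAlgCl 3)) (Φ.map (WeierstrassCurve.geomTorsion W ((3 : ℕ) : ℤ)).subtype) θsub → Literature.NumberTheory.EllipticCurves.KellerYin2024.IsTeichmullerLiftOnQuot (∅ : Set (PadicAlgCl 3)) (Φ.map (WeierstrassCurve.geomTorsion W ((3 : ℕ) : ℤ)).subtype) (WeierstrassCurve.geomTorsion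 W ((3 : ℕ) : ℤ)) θquot → ∀ (θunr θram : FramedGaloisRep ℚ (padicCoeffIntegers (∅ : Set (PadicAlgCl 3))) 1), ((θunr = θsub ∧ θram = θquot) ∨ (θunr = θquot ∧ θram = θsub)) → (∀ u : IsDedekindDomain.HeightOneSpectrum (NumberField.RingOfIntegers ℚ), ((3 : ℕ) : NumberField.RingOfIntegers ℚ) ∈ u.asIdeal → θunr.IsUnramifiedAt u) → Set.Finite {s : Literature.NumberTheory.EllipticCurves.KellerYin2024.unrSelmer κ (Literature.NumberTheory.EllipticCurves.KellerYin2024.charModule (∅ : Set (PadicAlgCl 3)) (θram.restrictField K)) 𝔭' (∅ : Set (IsDedekindDomain.HeightOneSpectrum (NumberField.RingOfIntegers K))) | (3 : ℕ) • s = 0})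
    (hlam : ∀ (W : WeierstrassCurve ℚ) [W.IsElliptic] [W.IsGloballyMinimal] (N : ℕ) [NeZero N] (K : Type) [Field K] [NumberField K], Summit.BirchSwinnertonDyer.Rank1Residual.Additive.ClassO6 W 3 → Literature.NumberTheory.EllipticCurves.Rank1Residual.Red W 3 → (∃ Φ : AddSubgroup (WeierstrassCurve.geomTorsion W ((3 : ℕ) : ℤ)), Literature.NumberTheory.EllipticCurves.Rank1Residual.IsRationalLine W 3 Φ ∧ ∀ (v : IsDedekindDomain.HeightOneSpectrum (NumberField.RingOfIntegers ℚ)), ((3 : ℕ) : NumberField.RingOfIntegers ℚ) ∈ v.asIdeal → ∀ 𝔓 ∈ v.primesAbove, ¬ (∀ g ∈ 𝔓.decompositionSubgroup (Field.absoluteGaloisGroup ℚ), ∀ P ∈ Φ, g • P = P) ∧ ¬ (∀ g ∈ 𝔓.decompositionSubgroup (Field.absoluteGaloisGroup ℚ), ∀ P : WeierstrassCurve.geomTorsion W ((3 : ℕ) : ℤ), g • P - P ∈ Φ)) → W.conductorNorm ℤ = N → Literature.NumberTheory.EllipticCurves.IsImaginaryQuadratic K → Literature.NumberTheory.EllipticCurves.SatisfiesHeegnerHypothesis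 N K → Odd (NumberField.discr K) → (∀ Q : (W.baseChange K).toAffine.Point, (3 : ℕ) • Q = 0 → Q = 0) → ∀ (κ : Literature.NumberTheory.EllipticCurves.ZpExtension K 3), κ.IsAnticyclotomic → ∀ (γ : Field.absoluteGaloisGroup K) [Fact (κ.IsTopGenerator γ)] (𝔭 : IsDedekindDomain.HeightOneSpectrum (NumberField.RingOfIntegers K)), ((3 : ℕ) : NumberField.RingOfIntegers K) ∈ 𝔭.asIdeal → 𝔭.asIdeal.ramificationIdx (NumberField.RingOfIntegers ℚ) = 1 → 𝔭.asIdeal.inertiaDeg (NumberField.RingOfIntegers ℚ) = 1 → ∀ (𝔭' : IsDedekindDomain.HeightOneSpectrum (NumberField.RingOfIntegers K)), ((3 : ℕ) : NumberField.RingOfIntegers K) ∈ 𝔭'.asIdeal → 𝔭' ≠ 𝔭 → ∀ (ι' : PadicAlgCl 3 ≃+* ℂ), Summit.BirchSwinnertonDyer.BirchSwinnertonDyer.Theorems.SchneiderFree.BranchInducesPrime 3 ι' 𝔭 → ∀ (Φ : AddSubgroup (WeierstrassCurve.geomTorsion W ((3 : ℕ) : ℤ))), Literature.NumberTheory.EllipticCurves.Rank1Residual.IsRationalLine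 W 3 Φ → ∀ (θsub θquot : FramedGaloisRep ℚ (padicCoeffIntegers (∅ : Set (PadicAlgCl 3))) 1), Literature.NumberTheory.EllipticCurves.KellerYin2024.IsTeichmullerLiftOn (∅ : Set (PadicAlgCl 3)) (Φ.map (WeierstrassCurve.geomTorsion W ((3 : ℕ) : ℤ)).subtype) θsub → Literature.NumberTheory.EllipticCurves.KellerYin2024.IsTeichmullerLiftOnQuot (∅ : Set (PadicAlgCl 3)) (Φ.map (WeierstrassCurve.geomTorsion W ((3 : ℕ) : ℤ)).subtype) (WeierstrassCurve.geomTorsion W ((3 : ℕ) : ℤ)) θquot → ∀ (θunr θram : FramedGaloisRep ℚ (padicCoeffIntegers (∅ : Set (PadicAlgCl 3))) 1), ((θunr = θsub ∧ θram = θquot) ∨ (θunr = θquot ∧ θram = θsub)) → (∀ u : IsDedekindDomain.HeightOneSpectrum (NumberField.RingOfIntegers ℚ), ((3 : ℕ) : NumberField.RingOfIntegers ℚ) ∈ u.asIdeal → θunr.IsUnramifiedAt u) → ∀ (θK : HeckeCharacter K), Literature.NumberTheory.EllipticCurves.KellerYin2024.IsHeckeCharOf ι' (θunr.restrictField K) θK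 → ∀ (Cbar : Finset (IsDedekindDomain.HeightOneSpectrum (NumberField.RingOfIntegers K))), (∀ u ∈ Cbar, ¬ θK.IsUnramifiedAt u) → ∀ (ΩK' : ℂ) (Ωp' : (Literature.NumberTheory.EllipticCurves.unrIntegers 3)ˣ) (Lφ : Literature.NumberTheory.EllipticCurves.UnrSeries 3), ΩK' ≠ 0 → Literature.NumberTheory.EllipticCurves.CastellaGrossiLeeSkinner2022.IsKatzLFunction ι' 𝔭 𝔭' Cbar κ γ θK ΩK' ((Ωp' : Literature.NumberTheory.EllipticCurves.unrIntegers 3) : ℂ_[3]) Lφ → ∀ nφ : ℕ, Literature.NumberTheory.EllipticCurves.KellerYin2024.FirstUnitCoeffAt Lφ nφ → ∀ (Dram : Literature.NumberTheory.EllipticCurves.GreenbergVatsal2000.DatumDualData κ γ (Literature.NumberTheory.EllipticCurves.KellerYin2024.charModule (∅ : Set (PadicAlgCl 3)) (θram.restrictField K)) (Literature.NumberTheory.EllipticCurves.Castella2018.AcSelmer.bdpData (Literature.NumberTheory.EllipticCurves.KellerYin2024.charModule (∅ : Set (PadicAlgCl 3)) (θram.restrictField K)) 3 𝔭') ∅),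 Literature.NumberTheory.EllipticCurves.lambdaInvariant 3 Dram.X = nφ) :
    ∀ (W : WeierstrassCurve ℚ) [W.IsElliptic] [W.IsGloballyMinimal] (N : ℕ) [NeZero N] (K : Type) [Field K] [NumberField K], Summit.BirchSwinnertonDyer.Rank1Residual.Additive.ClassO6 W 3 → Literature.NumberTheory.EllipticCurves.Rank1Residual.Red W 3 → (∃ Φ : AddSubgroup (WeierstrassCurve.geomTorsion W ((3 : ℕ) : ℤ)), Literature.NumberTheory.EllipticCurves.Rank1Residual.IsRationalLine W 3 Φ ∧ ∀ (v : IsDedekindDomain.HeightOneSpectrum (NumberField.RingOfIntegers ℚ)), ((3 : ℕ) : NumberField.RingOfIntegers ℚ) ∈ v.asIdeal → ∀ 𝔓 ∈ v.primesAbove, ¬ (∀ g ∈ 𝔓.decompositionSubgroup (Field.absoluteGaloisGroup ℚ), ∀ P ∈ Φ, g • P = P) ∧ ¬ (∀ g ∈ 𝔓.decompositionSubgroup (Field.absoluteGaloisGroup ℚ), ∀ P : WeierstrassCurve.geomTorsion W ((3 : ℕ) : ℤ), g • P - P ∈ Φ)) → W.conductorNorm ℤ = N → Literature.NumberTheory.EllipticCurves.IsImaginaryQuadratic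 K → Literature.NumberTheory.EllipticCurves.SatisfiesHeegnerHypothesis N K → Odd (NumberField.discr K) → (∀ Q : (W.baseChange K).toAffine.Point, (3 : ℕ) • Q = 0 → Q = 0) → ∀ (κ : Literature.NumberTheory.EllipticCurves.ZpExtension K 3), κ.IsAnticyclotomic → ∀ (γ : Field.absoluteGaloisGroup K) [Fact (κ.IsTopGenerator γ)] (𝔭 : IsDedekindDomain.HeightOneSpectrum (NumberField.RingOfIntegers K)), ((3 : ℕ) : NumberField.RingOfIntegers K) ∈ 𝔭.asIdeal → 𝔭.asIdeal.ramificationIdx (NumberField.RingOfIntegers ℚ) = 1 → 𝔭.asIdeal.inertiaDeg (NumberField.RingOfIntegers ℚ) = 1 → ∀ (𝔭' : IsDedekindDomain.HeightOneSpectrum (NumberField.RingOfIntegers K)), ((3 : ℕ) : NumberField.RingOfIntegers K) ∈ 𝔭'.asIdeal → 𝔭' ≠ 𝔭 → ∀ (ι' : PadicAlgCl 3 ≃+* ℂ), Summit.BirchSwinnertonDyer.BirchSwinnertonDyer.Theorems.SchneiderFree.BranchInducesPrime 3 ι' 𝔭 → ∀ (Φ : AddSubgroup (WeierstrassCurve.geomTorsion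 W ((3 : ℕ) : ℤ))), Literature.NumberTheory.EllipticCurves.Rank1Residual.IsRationalLine W 3 Φ → ∀ (θsub θquot : FramedGaloisRep ℚ (padicCoeffIntegers (∅ : Set (PadicAlgCl 3))) 1), Literature.NumberTheory.EllipticCurves.KellerYin2024.IsTeichmullerLiftOn (∅ : Set (PadicAlgCl 3)) (Φ.map (WeierstrassCurve.geomTorsion W ((3 : ℕ) : ℤ)).subtype) θsub → Literature.NumberTheory.EllipticCurves.KellerYin2024.IsTeichmullerLiftOnQuot (∅ : Set (PadicAlgCl 3)) (Φ.map (WeierstrassCurve.geomTorsion W ((3 : ℕ) : ℤ)).subtype) (WeierstrassCurve.geomTorsion W ((3 : ℕ) : ℤ)) θquot → ∀ (θunr θram : FramedGaloisRep ℚ (padicCoeffIntegers (∅ : Set (PadicAlgCl 3))) 1), ((θunr = θsub ∧ θram = θquot) ∨ (θunr = θquot ∧ θram = θsub)) → (∀ u : IsDedekindDomain.HeightOneSpectrum (NumberField.RingOfIntegers ℚ), ((3 : ℕ) : NumberField.RingOfIntegers ℚ) ∈ u.asIdeal → θunr.IsUnramifiedAt u) → ∀ (θK : HeckeCharacter K),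 Literature.NumberTheory.EllipticCurves.KellerYin2024.IsHeckeCharOf ι' (θunr.restrictField K) θK → ∀ (Cbar : Finset (IsDedekindDomain.HeightOneSpectrum (NumberField.RingOfIntegers K))), (∀ u ∈ Cbar, ¬ θK.IsUnramifiedAt u) → ∀ (ΩK' : ℂ) (Ωp' : (Literature.NumberTheory.EllipticCurves.unrIntegers 3)ˣ) (Lφ : Literature.NumberTheory.EllipticCurves.UnrSeries 3), ΩK' ≠ 0 → Literature.NumberTheory.EllipticCurves.CastellaGrossiLeeSkinner2022.IsKatzLFunction ι' 𝔭 𝔭' Cbar κ γ θK ΩK' ((Ωp' : Literature.NumberTheory.EllipticCurves.unrIntegers 3) : ℂ_[3]) Lφ → ∀ nφ : ℕ, Literature.NumberTheory.EllipticCurves.KellerYin2024.FirstUnitCoeffAt Lφ nφ → ∀ (Dram : Literature.NumberTheory.EllipticCurves.GreenbergVatsal2000.DatumDualData κ γ (Literature.NumberTheory.EllipticCurves.KellerYin2024.charModule (∅ : Set (PadicAlgCl 3)) (θram.restrictField K)) (Literature.NumberTheory.EllipticCurves.Castella2018.AcSelmer.bdpData (Literature.NumberTheory.EllipticCurves.KellerYin2024.charModule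 (∅ : Set (PadicAlgCl 3)) (θram.restrictField K)) 3 𝔭') ∅), Module.Finite (Literature.NumberTheory.EllipticCurves.IwasawaAlgebra 3) Dram.X ∧ Module.IsTorsion (Literature.NumberTheory.EllipticCurves.IwasawaAlgebra 3) Dram.X ∧ Literature.NumberTheory.EllipticCurves.muInvariant 3 Dram.X = 0 ∧ Literature.NumberTheory.EllipticCurves.lambdaInvariant 3 Dram.X = nφ := by
  intro W _ _ N _ K _ _ hO6 hRed hcell hN hK hHN hodd hEK κ hκ γ _ 𝔭 h𝔭 he hf 𝔭' h𝔭' hne ι' hι Φ hΦ θsub θquot hsub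
    hquot θunr θram hpr hunr θK hθK Cbar hCb ΩK' Ωp' Lφ hΩK' hLφ nφ hnφ Dram
  have hfin := hR W N K hO6 hRed hcell hN hK hHN hodd hEK κ hκ γ 𝔭 h𝔭 he hf 𝔭' h𝔭' hne ι' hι Φ hΦ θsub θquot hsub
    hquot θunr θram hpr hunr
  obtain ⟨hfg, hT, hμ⟩ :=
    EisensteinCharacterInvariantsAtThreeUnrSelmerDualMu.finite_torsion_mu_of_finite_pTorsion_unrSelmer κ 𝔭'
      (∅ : Set (HeightOneSpectrum (𝓞 K)))
      (exists_pow_smul_cofree_eq_zero (∅ : Set (PadicAlgCl 3)) (θram.restrictField K))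
      (isOpen_stabilizer_cofree (∅ : Set (PadicAlgCl 3)) (θram.restrictField K)) (Fact.out) Dram hfin
  exact ⟨hfg, hT, hμ, hlam W N K hO6 hRed hcell hN hK hHN hodd hEK κ hκ γ 𝔭 h𝔭 he hf 𝔭' h𝔭' hne ι' hι Φ hΦ θsub θquot
    hsub hquot θunr θram hpr hunr θK hθK Cbar hCb ΩK' Ωp' Lφ hΩK' hLφ nφ hnφ Dram⟩

end Summit.BirchSwinnertonDyer.BirchSwinnertonDyer.Theorems.EisensteinCharacterInvariantsAtThreeRamifiedSplit

end
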